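import Literature.NumberTheory.Automorphic.UnitaryGroupTorusIdeleUnfolding
import Literature.NumberTheory.Automorphic.UnitaryGroupTorusRankOneInterval
import HarnessLib

/-!
# Torus-to-idele unfolding for `U(J₃)` along the simple root `α₁ = d₀ d₁⁻¹` (central fibre):
# `∫_{T(F)∖T(𝔸_F)} G(d₀ t · (d₁ t)⁻¹) dt = C · ∫_{E^×∖𝕀_E} G(x) dx`
(Rogawski, *Automorphic Representations of Unitary Groups in Three Variables* (1990), §7.3 p. 97: for the central∕Heisenberg
terms the torus `M` acts on the root coordinate through `α₁(m)`, the integral over `M S′∖M` with `S′ = ker α₁ = Z` becomes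
`m(Z S′∖S′) ∫_{E^*∖I_E} […] d^*a`; Folland (1995), §2.6 Thm. 2.49 for the Weil formula)

Topic `NumberTheory/Automorphic`; namespace `Literature.NumberTheory.Automorphic.UnitaryGroup`. THEOREMS ONLY over accepted
tree modules: no definition, no named fact, no instance, no notation, no `sorry`. Row (C-torus) FILE 2b of the T1-qs LAW 5 road of
`Cruxes/H413/Lines/F0_T1InnerFormTraceIdentity.lean` (cell `pub/hodgecm-mathlib`, crux H413), the (E2) letter of the Heisenberg part:
the COMPANION of ★ `UnitaryGroupTorusIdeleUnfolding` (the `d₀`-push) for the homomorphism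

  `α₁ : T(𝔸_F) →* 𝕀_E`, `t = diag(d₀, d₁, d₂) ↦ d₀ · d₁⁻¹`

(written inline as `MonoidHom.mk' (fun t => diagUnit t.2 0 * (diagUnit t.2 1)⁻¹) diagUnitRatio_torus_mul`; no definition), whose
kernel is the CENTRE `Z(𝔸_F) = {diag(b, b, b) : c(b) b = 1} ≅ U(1)_{E/F}(𝔸_F)` (Rogawski's `S′`). Same letters as the `d₀` file:
`T = torusInBorel F E c 3`, `Γ_T = (rationalBorel F E c 3).subgroupOf T`, covering weights (★ `CoveringWeights`), `principalIdeles E`,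
`IsIdeleClassDomain` (★ `IdeleClassIntegration`).

* §1 `α₁` is multiplicative (`diagUnitRatio_torus_mul`), continuous, surjective (`diag(a, 1, (c a)⁻¹) ↦ a`), OPEN (open mapping
  theorem) and maps `Γ_T` ONTO `Eˣ`: **`map_rationalTorusInBorel_diagUnitRatio_eq_principalIdeles`** (both diagonal entries of a
  rational torus element are principal: `diagUnit_one_mem_principalIdeles_of_mem`).
* §2 THE CENTRAL FIBRE HAS FINITE COVOLUME: **`exists_isCoveringWeight_ker_diagUnitRatio`** (Godement's compact cover
  ★ `exists_isCompact_adelicOne_cover`, the compactum `{d₀ ∈ W₁, d₁ ∈ W₁, d₀ = d₁}` ★ `isCompact_setOf_diagUnit_mem`, rational central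
  translates `diag(q, q, q)` ★ `exists_rational_torus`, and the generic ★ `exists_isCoveringWeight_subgroupOf_of_measure_ne_top`).
* §3 THE ROW **`exists_lintegral_comp_diagUnitRatio_mul_weight_eq`**: `[E : F] = 2`, `c² = 1`, `c ≠ 1`, Haar `μT`, `μE`:
  `∃ C ∈ (0, ∞)`, for every `Γ_T`-covering weight `w`, every `principalIdeles E`-covering weight `wE` and every Borel `Eˣ`-invariant
  `G ≥ 0`: **`∫⁻ G(d₀ t (d₁ t)⁻¹) w(t) dμT = C · ∫⁻ G(x) wE(x) dμE`**, and **`…_eq_setLIntegral`** against an idele class domain `𝓕`.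
* §4 (edition 2) THE HEIGHT DICTIONARY **`borelHeight_torus_coe_eq_ideleNorm_diagUnitRatio_mul`**: `H(t) = ‖α₁(t)‖ · H(1)`
  (`‖d₁(t)‖ = 1`: `ideleNorm_diagUnit_one_eq_one`; `‖α₁(t)‖ = ‖d₀(t)‖`: `ideleNorm_diagUnitRatio_eq`; ★ `borelHeight_torus_coe`).

## References

* J. D. Rogawski, *Automorphic Representations of Unitary Groups in Three Variables*, Ann. of Math. Stud. 123 (1990), §1.10,
  §7.3 (p. 97) [Rogawski1990].
* G. B. Folland, *A Course in Abstract Harmonic Analysis* (1995), §2.6 Thm. 2.49 [Folland1995].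
* R. Godement, *Domaines fondamentaux des groupes arithmétiques*, Sém. Bourbaki 257 (1964), §5 Thm. 4 [Godement1964].
-/

set_option autoImplicit false

noncomputable section

open MeasureTheory Measure NumberField IsDedekindDomain Set Literature.MeasureTheory.Group
open scoped ENNReal NNReal

namespace Literature.NumberTheory.Automorphic

namespace UnitaryGroup

variable {F E : Type} [Field F] [NumberField F] [Field E] [NumberField E] [Algebra F E] {c : E ≃ₐ[F] E}

/-! ## §1 The projection `α₁ = d₀ d₁⁻¹ : T(𝔸_F) →* 𝕀_E` -/

section Projection

/-- **`t ↦ d₀(t) d₁(t)⁻¹` is multiplicative** on the torus (★ `diagUnit_torus_mul`, the ideles are commutative).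
[cite: Rogawski1990, §1.10] -/
theorem diagUnitRatio_torus_mul (t t' : (torusInBorel F E c 3)) :
    diagUnit ((t * t' : (torusInBorel F E c 3)) : borelAdelic F E c 3).2 0 * (diagUnit ((t * t' : (torusInBorel F E c 3)) : borelAdelic F E c 3).2 1)⁻¹ =
      diagUnit (t : borelAdelic F E c 3).2 0 * (diagUnit (t : borelAdelic F E c 3).2 1)⁻¹ *
        (diagUnit (t' : borelAdelic F E c 3).2 0 * (diagUnit (t' : borelAdelic F E c 3).2 1)⁻¹) := by
  rw [diagUnit_torus_mul, diagUnit_torus_mul, mul_inv, mul_mul_mul_comm]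

/-- `α₁` evaluates to `d₀ d₁⁻¹` (definitional). [cite: Rogawski1990, §1.10] -/
theorem diagUnitRatioHom_apply (t : (torusInBorel F E c 3)) :
    (MonoidHom.mk' (fun t : torusInBorel F E c 3 =>
      diagUnit (t : borelAdelic F E c 3).2 0 * (diagUnit (t : borelAdelic F E c 3).2 1)⁻¹) diagUnitRatio_torus_mul) t = diagUnit (t : borelAdelic F E c 3).2 0 * (diagUnit (t : borelAdelic F E c 3).2 1)⁻¹ := rfl

/-- **`α₁` is continuous** (★ `continuous_diagUnit_torus` twice). [cite: Rogawski1990, §1.10] -/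
theorem continuous_diagUnitRatioHom : Continuous (MonoidHom.mk' (fun t : torusInBorel F E c 3 =>
      diagUnit (t : borelAdelic F E c 3).2 0 * (diagUnit (t : borelAdelic F E c 3).2 1)⁻¹) diagUnitRatio_torus_mul) :=
  (continuous_diagUnit_torus (F := F) (E := E) (c := c) 0).mul (continuous_diagUnit_torus (F := F) (E := E) (c := c) 1).inv

/-- **`α₁` is surjective**: `diag(a, 1, (c a)⁻¹) ↦ a` (★ `exists_torus_diagUnit_eq`). [cite: Rogawski1990, §1.10] -/
theorem diagUnitRatioHom_surjective (hc : c * c = 1) : Function.Surjective (MonoidHom.mk' (fun t : torusInBorel F E c 3 =>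
      diagUnit (t : borelAdelic F E c 3).2 0 * (diagUnit (t : borelAdelic F E c 3).2 1)⁻¹) diagUnitRatio_torus_mul) := by
  intro a
  obtain ⟨t, -, h0, h1⟩ := exists_torus_diagUnit_eq (F := F) hc a 1 (by rw [Units.val_one, map_one, one_mul])
  refine ⟨t, ?_⟩
  rw [diagUnitRatioHom_apply, h0, h1, inv_one, mul_one]

/-- **`α₁` is an open map** (open mapping theorem for the σ-compact `T(𝔸_F)` onto the locally compact `𝕀_E`, Mathlib
`MonoidHom.isOpenMap_of_sigmaCompact`). [cite: Folland1995, §2.6] -/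
theorem isOpenMap_diagUnitRatioHom (hc : c * c = 1) : IsOpenMap (MonoidHom.mk' (fun t : torusInBorel F E c 3 =>
      diagUnit (t : borelAdelic F E c 3).2 0 * (diagUnit (t : borelAdelic F E c 3).2 1)⁻¹) diagUnitRatio_torus_mul) := by
  obtain ⟨hT1, hT2, hT3⟩ := locallyCompactSpace_secondCountable_t2_torusInBorel (F := F) (E := E) (c := c)
  obtain ⟨hI1, hI2, hI3⟩ := locallyCompactSpace_secondCountable_t2_idele (E := E)
  exact MonoidHom.isOpenMap_of_sigmaCompact _ (diagUnitRatioHom_surjective hc) continuous_diagUnitRatioHom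

/-- The SECOND diagonal entry of a rational torus element is a principal idele (the entries of a rational matrix are rational).
[cite: Rogawski1990, §1.10] -/
theorem diagUnit_one_mem_principalIdeles_of_mem (τ : ((rationalBorel F E c 3).subgroupOf (torusInBorel F E c 3))) :
    diagUnit (((τ : (torusInBorel F E c 3)) : borelAdelic F E c 3)).2 1 ∈ GaloisRepresentations.principalIdeles E := by
  -- the rational matrix behind `τ`
  obtain ⟨γ, hγ⟩ := (τ.2 : (((τ : (torusInBorel F E c 3)) : borelAdelic F E c 3) : (quasiSplit F E c 3).Adelic) ∈
    (quasiSplit F E c 3).arithmeticSubgroup)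
  have hγ' : (((τ : (torusInBorel F E c 3)) : borelAdelic F E c 3) : (quasiSplit F E c 3).Adelic) = (quasiSplit F E c 3).toAdelic γ := hγ.symm
  have hval : ((diagUnit (((τ : (torusInBorel F E c 3)) : borelAdelic F E c 3)).2 1 : (AdeleRing (𝓞 E) E)ˣ) : AdeleRing (𝓞 E) E) =
      algebraMap E (AdeleRing (𝓞 E) E) (((γ.val : GL (Fin 3) E) : Matrix (Fin 3) (Fin 3) E) 1 1) := by
    have h1 : ((diagUnit (((τ : (torusInBorel F E c 3)) : borelAdelic F E c 3)).2 1 : (AdeleRing (𝓞 E) E)ˣ) : AdeleRing (𝓞 E) E) =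
        ((adelicVal F E c 3 _ (((τ : (torusInBorel F E c 3)) : borelAdelic F E c 3) : (quasiSplit F E c 3).Adelic) :
          GL (Fin 3) (AdeleRing (𝓞 E) E)) : Matrix (Fin 3) (Fin 3) (AdeleRing (𝓞 E) E)) 1 1 := rfl
    rw [h1, hγ']
    rfl
  haveI : Nontrivial (AdeleRing (𝓞 E) E) := (AdeleRing.algebraMap_injective (𝓞 E) E).nontrivial
  have hne : (((γ.val : GL (Fin 3) E) : Matrix (Fin 3) (Fin 3) E) 1 1) ≠ 0 := by
    intro h0
    have h1 := (diagUnit (((τ : (torusInBorel F E c 3)) : borelAdelic F E c 3)).2 1).ne_zero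
    rw [hval, h0, map_zero] at h1
    exact h1 rfl
  refine ⟨Units.mk0 _ hne, Units.ext ?_⟩
  rw [hval]
  rfl

/-- **`α₁(Γ_T) = Eˣ`**: the rational torus maps ONTO the principal ideles (`⊆`: both entries are principal;
`⊇`: `diag(k, 1, (c k)⁻¹) ∈ T(F)`, ★ `exists_rational_torus`). [cite: Rogawski1990, §1.10; §7.3 (p. 97)] -/
theorem map_rationalTorusInBorel_diagUnitRatio_eq_principalIdeles (hc : c * c = 1) :
    ((rationalBorel F E c 3).subgroupOf (torusInBorel F E c 3)).map (MonoidHom.mk' (fun t : torusInBorel F E c 3 =>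
      diagUnit (t : borelAdelic F E c 3).2 0 * (diagUnit (t : borelAdelic F E c 3).2 1)⁻¹) diagUnitRatio_torus_mul) = GaloisRepresentations.principalIdeles E := by
  ext x
  constructor
  · rintro ⟨τ, hτ, rfl⟩
    exact Subgroup.mul_mem _ (diagUnit_zero_mem_principalIdeles_of_mem ⟨τ, hτ⟩)
      (Subgroup.inv_mem _ (diagUnit_one_mem_principalIdeles_of_mem ⟨τ, hτ⟩))
  · rintro ⟨k, rfl⟩
    obtain ⟨τ, hτA, hτT, hτ0, hτ1⟩ := exists_rational_torus (F := F) (c := c)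
      (fun x => by rw [← AlgEquiv.mul_apply, hc, AlgEquiv.one_apply]) k 1 (by rw [Units.val_one, map_one, one_mul])
    refine ⟨⟨τ, (mem_torusInBorel_iff_torusPart_eq τ).2 hτT⟩, hτA, ?_⟩
    rw [diagUnitRatioHom_apply]
    change diagUnit τ.2 0 * (diagUnit τ.2 1)⁻¹ = _
    rw [hτ0, hτ1, map_one, inv_one, mul_one]

end Projection

/-! ## §2 The central fibre `ker α₁ = Z(𝔸_F) ≅ U(1)_{E/F}(𝔸_F)` has finite covolume modulo `Γ_T ⊓ ker α₁` -/

section Fibre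

/-- On the fibre `ker α₁`: `d₀ = d₁ ∈ U(1)(𝔸_F)` (★ `diagUnit_one_mem_adelicOne`). [cite: Rogawski1990, §1.10] -/
theorem diagUnit_of_mem_ker_diagUnitRatio (s : (torusInBorel F E c 3)) (hs : s ∈ (MonoidHom.mk' (fun t : torusInBorel F E c 3 =>
      diagUnit (t : borelAdelic F E c 3).2 0 * (diagUnit (t : borelAdelic F E c 3).2 1)⁻¹) diagUnitRatio_torus_mul).ker) :
    diagUnit (s : borelAdelic F E c 3).2 0 = diagUnit (s : borelAdelic F E c 3).2 1 ∧
      diagUnit (s : borelAdelic F E c 3).2 1 ∈ adelicOne F E c :=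
  ⟨mul_inv_eq_one.1 ((MonoidHom.mem_ker).1 hs), diagUnit_one_mem_adelicOne (torusPart_eq_self_of_mem s.2)⟩

/-- **Godement's compact set of representatives on the central fibre.** For `[E : F] = 2`, `c² = 1`, `c ≠ 1` there is a compact
`KT ⊆ {t : d₀ t (d₁ t)⁻¹ = 1}` such that every `s` with `d₀ s = d₁ s` is moved into `KT` by a rational CENTRAL torus element
`τ = diag(q, q, q)`, `q ∈ E¹`: `U(1)(𝔸_F) = W₁ · E¹` with `W₁` compact (★ `exists_isCompact_adelicOne_cover`), `KT = {d₀ ∈ W₁, d₁ ∈ W₁,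
d₀ = d₁}` (★ `isCompact_setOf_diagUnit_mem`), `τ` from ★ `exists_rational_torus`. [cite: Godement1964, §5 Thm. 4]
[cite: Rogawski1990, §7.3 (p. 97)] -/
theorem exists_isCompact_forall_exists_rationalTorus_mul_mem_central (h2 : Module.finrank F E = 2) (hc : c * c = 1)
    (hc1 : c ≠ 1) :
    ∃ KT : Set (torusInBorel F E c 3), IsCompact KT ∧
      KT ⊆ {t | diagUnit (t : borelAdelic F E c 3).2 0 * (diagUnit (t : borelAdelic F E c 3).2 1)⁻¹ = 1} ∧
      ∀ s : (torusInBorel F E c 3), diagUnit (s : borelAdelic F E c 3).2 0 * (diagUnit (s : borelAdelic F E c 3).2 1)⁻¹ = 1 →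
        ∃ τ : (torusInBorel F E c 3), τ ∈ ((rationalBorel F E c 3).subgroupOf (torusInBorel F E c 3)) ∧ diagUnit (τ : borelAdelic F E c 3).2 0 * (diagUnit (τ : borelAdelic F E c 3).2 1)⁻¹ = 1 ∧
          τ * s ∈ KT := by
  obtain ⟨W₁, hW₁c, -, hcov⟩ := exists_isCompact_adelicOne_cover F E c h2 hc1
  haveI := t2Space_ideleGroup E
  refine ⟨{t | diagUnit (t : borelAdelic F E c 3).2 0 ∈ W₁ ∧ diagUnit (t : borelAdelic F E c 3).2 1 ∈ W₁} ∩
      {t | diagUnit (t : borelAdelic F E c 3).2 0 * (diagUnit (t : borelAdelic F E c 3).2 1)⁻¹ = 1},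
    (isCompact_setOf_diagUnit_mem hc hW₁c hW₁c).inter_right
      (isClosed_eq ((continuous_diagUnit_torus (F := F) (E := E) (c := c) 0).mul
        (continuous_diagUnit_torus (F := F) (E := E) (c := c) 1).inv) continuous_const),
    fun t ht => ht.2, fun s hs => ?_⟩
  have hs01 : diagUnit (s : borelAdelic F E c 3).2 0 = diagUnit (s : borelAdelic F E c 3).2 1 := mul_inv_eq_one.1 hs
  have hs1 : diagUnit (s : borelAdelic F E c 3).2 1 ∈ adelicOne F E c :=
    diagUnit_one_mem_adelicOne (torusPart_eq_self_of_mem s.2)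
  obtain ⟨q, hqA, hqW⟩ := hcov _ hs1
  have hq : c (q : E) * q = 1 := by
    have h := (mem_adelicOne_iff F E c _).1 hqA
    rw [principalIdele_eq_unitsMap] at h
    change conjAdele F E c (algebraMap E (AdeleRing (𝓞 E) E) (q : E)) * algebraMap E (AdeleRing (𝓞 E) E) (q : E) = 1 at h
    rw [← algebraMap_conj, ← map_mul] at h
    exact (AdeleRing.algebraMap_injective (𝓞 E) E) (by rw [map_one]; simpa using h)
  -- the rational central element `diag(q, q, q)` (`(c q)⁻¹ = q`)
  obtain ⟨τ, hτA, hτT, hτ0, hτ1⟩ := exists_rational_torus (F := F) (c := c)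
    (fun x => by rw [← AlgEquiv.mul_apply, hc, AlgEquiv.one_apply]) q q hq
  have hτT' : τ ∈ (torusInBorel F E c 3) := (mem_torusInBorel_iff_torusPart_eq τ).2 hτT
  have hτ0' : diagUnit (((⟨τ, hτT'⟩ : (torusInBorel F E c 3)) : borelAdelic F E c 3)).2 0 = principalIdele E q := hτ0
  have hτ1' : diagUnit (((⟨τ, hτT'⟩ : (torusInBorel F E c 3)) : borelAdelic F E c 3)).2 1 = principalIdele E q := hτ1
  refine ⟨⟨τ, hτT'⟩, Subgroup.mem_subgroupOf.2 (Subgroup.mem_comap.2 hτA), ?_, ⟨?_, ?_⟩, ?_⟩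
  · rw [hτ0', hτ1', mul_inv_cancel]
  · rw [diagUnit_torus_mul, hτ0', hs01, mul_comm]
    exact hqW
  · rw [diagUnit_torus_mul, hτ1', mul_comm]
    exact hqW
  · show diagUnit (((⟨τ, hτT'⟩ : (torusInBorel F E c 3)) * s : (torusInBorel F E c 3)) : borelAdelic F E c 3).2 0 *
      (diagUnit (((⟨τ, hτT'⟩ : (torusInBorel F E c 3)) * s : (torusInBorel F E c 3)) : borelAdelic F E c 3).2 1)⁻¹ = 1
    rw [diagUnit_torus_mul, diagUnit_torus_mul, hτ0', hτ1', hs01, mul_inv_cancel]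

variable [MeasurableSpace (quasiSplit F E c 3).Adelic] [BorelSpace (quasiSplit F E c 3).Adelic]

/-- **THE CENTRAL FIBRE HAS FINITE COVOLUME** (form for any homomorphism `α` agreeing with `d₀ d₁⁻¹` pointwise): for `[E : F] = 2`,
`c² = 1`, `c ≠ 1` and every Haar measure `μS` on `ker α ≤ T(𝔸_F)` there is a `(Γ_T ⊓ ker α)`-covering weight on `ker α` of finite
`μS`-integral (the compactum of `exists_isCompact_forall_exists_rationalTorus_mul_mem_central` meets every orbit; generic
★ `exists_isCoveringWeight_subgroupOf_of_measure_ne_top`). [cite: Godement1964, §5 Thm. 4] [cite: Rogawski1990, §7.3 (p. 97)] -/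
theorem exists_isCoveringWeight_ker_of_eq_diagUnitRatio (h2 : Module.finrank F E = 2) (hc : c * c = 1) (hc1 : c ≠ 1)
    (α : (torusInBorel F E c 3) →* (AdeleRing (𝓞 E) E)ˣ) (hα : ∀ t, α t = diagUnit (t : borelAdelic F E c 3).2 0 * (diagUnit (t : borelAdelic F E c 3).2 1)⁻¹)
    (μS : Measure α.ker) [IsHaarMeasure μS] :
    ∃ wS : α.ker → ℝ≥0∞, IsCoveringWeight (((rationalBorel F E c 3).subgroupOf (torusInBorel F E c 3)).subgroupOf α.ker) wS ∧ ∫⁻ s, wS s ∂μS ≠ ∞ := by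
  obtain ⟨hT1, hT2, hT3⟩ := locallyCompactSpace_secondCountable_t2_torusInBorel (F := F) (E := E) (c := c)
  haveI := discreteTopology_rationalTorusInBorel (F := F) (E := E) (c := c)
  haveI := countable_rationalTorusInBorel (F := F) (E := E) (c := c) (N := 3)
  obtain ⟨KT, hKTc, hKT0, hcov⟩ :=
    exists_isCompact_forall_exists_rationalTorus_mul_mem_central (F := F) (E := E) (c := c) h2 hc hc1
  -- `KT ⊆ ker α`, so its preimage in the fibre is compact
  have hKTker : ∀ t ∈ KT, t ∈ α.ker := fun t ht => by
    rw [MonoidHom.mem_ker, hα]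
    exact hKT0 ht
  have hKc : IsCompact (Subtype.val ⁻¹' KT : Set α.ker) := by
    rw [Subtype.isCompact_iff, Set.image_preimage_eq_of_subset (fun t ht => ⟨⟨t, hKTker t ht⟩, rfl⟩)]
    exact hKTc
  refine exists_isCoveringWeight_subgroupOf_of_measure_ne_top ((rationalBorel F E c 3).subgroupOf (torusInBorel F E c 3)) α.ker μS hKc.isClosed.measurableSet
    hKc.measure_lt_top.ne fun s => ?_
  -- every orbit meets the compactum: translate by the rational central `diag(q, q, q)`
  have hs0 : diagUnit ((s : (torusInBorel F E c 3)) : borelAdelic F E c 3).2 0 * (diagUnit ((s : (torusInBorel F E c 3)) : borelAdelic F E c 3).2 1)⁻¹ = 1 := by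
    rw [← hα]
    exact (MonoidHom.mem_ker).1 s.2
  obtain ⟨τ, hτΓ, hτ0, hτs⟩ := hcov (s : (torusInBorel F E c 3)) hs0
  have hτker : τ ∈ α.ker := by
    rw [MonoidHom.mem_ker, hα]
    exact hτ0
  exact ⟨⟨τ, hτker⟩, hτΓ, hτs⟩

/-- **THE FIBRE OF `α₁` (THE CENTRE) HAS FINITE COVOLUME**: for `[E : F] = 2`, `c² = 1`, `c ≠ 1` and every Haar measure `μS` on
`ker α₁ = Z(𝔸_F)` there is a `(Γ_T ⊓ Z(𝔸_F))`-covering weight on it of finite `μS`-integral (`Z(F)∖Z(𝔸_F) ≅ E¹∖U(1)(𝔸_F)` compact —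
Godement; Rogawski's `m(Z S′∖S′) < ∞`). [cite: Godement1964, §5 Thm. 4] [cite: Rogawski1990, §7.3 (p. 97)] -/
theorem exists_isCoveringWeight_ker_diagUnitRatio (h2 : Module.finrank F E = 2) (hc : c * c = 1) (hc1 : c ≠ 1)
    (μS : Measure (MonoidHom.mk' (fun t : torusInBorel F E c 3 =>
      diagUnit (t : borelAdelic F E c 3).2 0 * (diagUnit (t : borelAdelic F E c 3).2 1)⁻¹) diagUnitRatio_torus_mul).ker) [IsHaarMeasure μS] :
    ∃ wS : (MonoidHom.mk' (fun t : torusInBorel F E c 3 =>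
      diagUnit (t : borelAdelic F E c 3).2 0 * (diagUnit (t : borelAdelic F E c 3).2 1)⁻¹) diagUnitRatio_torus_mul).ker → ℝ≥0∞,
      IsCoveringWeight (((rationalBorel F E c 3).subgroupOf (torusInBorel F E c 3)).subgroupOf (MonoidHom.mk' (fun t : torusInBorel F E c 3 =>
      diagUnit (t : borelAdelic F E c 3).2 0 * (diagUnit (t : borelAdelic F E c 3).2 1)⁻¹) diagUnitRatio_torus_mul).ker) wS ∧ ∫⁻ s, wS s ∂μS ≠ ∞ :=
  exists_isCoveringWeight_ker_of_eq_diagUnitRatio h2 hc hc1 (MonoidHom.mk' (fun t : torusInBorel F E c 3 =>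
      diagUnit (t : borelAdelic F E c 3).2 0 * (diagUnit (t : borelAdelic F E c 3).2 1)⁻¹) diagUnitRatio_torus_mul) (fun _ => rfl) μS

end Fibre

/-! ## §3 The row: `∫_{T(F)∖T(𝔸_F)} G(d₀ t (d₁ t)⁻¹) dt = C · ∫_{Eˣ∖𝕀_E} G` -/

section Row

variable [MeasurableSpace (quasiSplit F E c 3).Adelic] [BorelSpace (quasiSplit F E c 3).Adelic]
  [MeasurableSpace (AdeleRing (𝓞 E) E)ˣ] [BorelSpace (AdeleRing (𝓞 E) E)ˣ]

/-- **TORUS-TO-IDELE UNFOLDING ALONG `α₁ = d₀ d₁⁻¹`.** For a quadratic `E/F` (`[E : F] = 2`) with involution `c` (`c² = 1`,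
`c ≠ 1`), Haar measures `μT` on `T(𝔸_F)` and `μE` on `𝕀_E`: there is `C ∈ (0, ∞)` such that for every covering weight `w` of the
rational torus `Γ_T`, every covering weight `wE` of the principal ideles and every Borel `Eˣ`-invariant `G : 𝕀_E → [0, ∞]`,
`∫⁻ G(d₀ t · (d₁ t)⁻¹) w(t) dμT = C · ∫⁻ G(x) wE(x) dμE` — i.e. `∫_{T(F)∖T(𝔸_F)} G ∘ α₁ = C ∫_{Eˣ∖𝕀_E} G`, the constant absorbing
`m(Z(F)∖Z(𝔸_F))` (★ `CoveringWeightsPushforward` at `α = α₁`: abelian ★ `torusInBorel_comm`, open §1, `Λ = Eˣ` §1, fibre §2).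
[cite: Rogawski1990, §7.3 (p. 97)] [cite: Folland1995, §2.6 Thm. 2.49] -/
theorem exists_lintegral_comp_diagUnitRatio_mul_weight_eq (h2 : Module.finrank F E = 2) (hc : c * c = 1) (hc1 : c ≠ 1)
    (μT : Measure (torusInBorel F E c 3)) [IsHaarMeasure μT] (μE : Measure (AdeleRing (𝓞 E) E)ˣ) [IsHaarMeasure μE] :
    ∃ C : ℝ≥0∞, C ≠ 0 ∧ C ≠ ∞ ∧ ∀ w : (torusInBorel F E c 3) → ℝ≥0∞, IsCoveringWeight ((rationalBorel F E c 3).subgroupOf (torusInBorel F E c 3)) w →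
      ∀ wE : (AdeleRing (𝓞 E) E)ˣ → ℝ≥0∞, IsCoveringWeight (GaloisRepresentations.principalIdeles E) wE →
      ∀ G : (AdeleRing (𝓞 E) E)ˣ → ℝ≥0∞, Measurable G → (∀ k ∈ GaloisRepresentations.principalIdeles E, ∀ x, G (k * x) = G x) →
        ∫⁻ t, G (diagUnit (t : borelAdelic F E c 3).2 0 * (diagUnit (t : borelAdelic F E c 3).2 1)⁻¹) * w t ∂μT =
          C * ∫⁻ x, G x * wE x ∂μE := by
  obtain ⟨hT1, hT2, hT3⟩ := locallyCompactSpace_secondCountable_t2_torusInBorel (F := F) (E := E) (c := c)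
  obtain ⟨hI1, hI2, hI3⟩ := locallyCompactSpace_secondCountable_t2_idele (E := E)
  haveI := discreteTopology_rationalTorusInBorel (F := F) (E := E) (c := c)
  haveI := countable_rationalTorusInBorel (F := F) (E := E) (c := c) (N := 3)
  haveI : IsClosed (((MonoidHom.mk' (fun t : torusInBorel F E c 3 =>
      diagUnit (t : borelAdelic F E c 3).2 0 * (diagUnit (t : borelAdelic F E c 3).2 1)⁻¹) diagUnitRatio_torus_mul).ker : Subgroup (torusInBorel F E c 3)) : Set (torusInBorel F E c 3)) := by
    haveI := t2Space_ideleGroup E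
    rw [MonoidHom.coe_ker]
    exact isClosed_singleton.preimage continuous_diagUnitRatioHom
  letI : CommGroup (torusInBorel F E c 3) := { (inferInstance : Group (torusInBorel F E c 3)) with mul_comm := torusInBorel_comm }
  -- a Haar measure on the fibre and its finite-covolume witness
  obtain ⟨wS, hwS, hfin⟩ := exists_isCoveringWeight_ker_diagUnitRatio h2 hc hc1 (Measure.haar : Measure (MonoidHom.mk' (fun t : torusInBorel F E c 3 =>
      diagUnit (t : borelAdelic F E c 3).2 0 * (diagUnit (t : borelAdelic F E c 3).2 1)⁻¹) diagUnitRatio_torus_mul).ker)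
  obtain ⟨C, hC0, hCt, hC⟩ := exists_lintegral_comp_mul_weight_eq_mul_lintegral (MonoidHom.mk' (fun t : torusInBorel F E c 3 =>
      diagUnit (t : borelAdelic F E c 3).2 0 * (diagUnit (t : borelAdelic F E c 3).2 1)⁻¹) diagUnitRatio_torus_mul) ((rationalBorel F E c 3).subgroupOf (torusInBorel F E c 3)) continuous_diagUnitRatioHom
    (isOpenMap_diagUnitRatioHom hc) (diagUnitRatioHom_surjective hc) μT μE (Measure.haar : Measure (MonoidHom.mk' (fun t : torusInBorel F E c 3 =>
      diagUnit (t : borelAdelic F E c 3).2 0 * (diagUnit (t : borelAdelic F E c 3).2 1)⁻¹) diagUnitRatio_torus_mul).ker) hwS hfin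
  refine ⟨C, hC0, hCt, fun w hw wE hwE G hG hGinv => ?_⟩
  have hmap := map_rationalTorusInBorel_diagUnitRatio_eq_principalIdeles (F := F) (E := E) (c := c) hc
  have hwE' : IsCoveringWeight (((rationalBorel F E c 3).subgroupOf (torusInBorel F E c 3)).map (MonoidHom.mk' (fun t : torusInBorel F E c 3 =>
      diagUnit (t : borelAdelic F E c 3).2 0 * (diagUnit (t : borelAdelic F E c 3).2 1)⁻¹) diagUnitRatio_torus_mul)) wE := by rw [hmap]; exact hwE
  have hGinv' : ∀ l ∈ ((rationalBorel F E c 3).subgroupOf (torusInBorel F E c 3)).map (MonoidHom.mk' (fun t : torusInBorel F E c 3 =>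
      diagUnit (t : borelAdelic F E c 3).2 0 * (diagUnit (t : borelAdelic F E c 3).2 1)⁻¹) diagUnitRatio_torus_mul), ∀ x : (AdeleRing (𝓞 E) E)ˣ, G (l * x) = G x := by rw [hmap]; exact hGinv
  exact hC w hw wE hwE' G hG hGinv'

/-- **The same against an idele class domain** `𝓕 ⊆ 𝕀_E` (`IsIdeleClassDomain E 𝓕`): `∫⁻ G(d₀ t (d₁ t)⁻¹) w(t) dμT = C · ∫⁻_{𝓕} G dμE`
for every `Γ_T`-covering weight `w` and Borel `Eˣ`-invariant `G ≥ 0` — the shape `m(Z S′∖S′) ∫_{E^*∖I_E}` of [Rogawski1990, p. 97].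
[cite: Rogawski1990, §7.3 (p. 97)] [cite: Folland1995, §2.6 Thm. 2.49] -/
theorem exists_lintegral_comp_diagUnitRatio_mul_weight_eq_setLIntegral (h2 : Module.finrank F E = 2) (hc : c * c = 1)
    (hc1 : c ≠ 1) (μT : Measure (torusInBorel F E c 3)) [IsHaarMeasure μT] (μE : Measure (AdeleRing (𝓞 E) E)ˣ) [IsHaarMeasure μE] :
    ∃ C : ℝ≥0∞, C ≠ 0 ∧ C ≠ ∞ ∧ ∀ w : (torusInBorel F E c 3) → ℝ≥0∞, IsCoveringWeight ((rationalBorel F E c 3).subgroupOf (torusInBorel F E c 3)) w →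
      ∀ 𝓕 : Set (AdeleRing (𝓞 E) E)ˣ, IsIdeleClassDomain E 𝓕 →
      ∀ G : (AdeleRing (𝓞 E) E)ˣ → ℝ≥0∞, Measurable G → (∀ k ∈ GaloisRepresentations.principalIdeles E, ∀ x, G (k * x) = G x) →
        ∫⁻ t, G (diagUnit (t : borelAdelic F E c 3).2 0 * (diagUnit (t : borelAdelic F E c 3).2 1)⁻¹) * w t ∂μT =
          C * ∫⁻ x in 𝓕, G x ∂μE := by
  obtain ⟨hT1, hT2, hT3⟩ := locallyCompactSpace_secondCountable_t2_torusInBorel (F := F) (E := E) (c := c)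
  obtain ⟨hI1, hI2, hI3⟩ := locallyCompactSpace_secondCountable_t2_idele (E := E)
  haveI := discreteTopology_rationalTorusInBorel (F := F) (E := E) (c := c)
  haveI := countable_rationalTorusInBorel (F := F) (E := E) (c := c) (N := 3)
  haveI : IsClosed (((MonoidHom.mk' (fun t : torusInBorel F E c 3 =>
      diagUnit (t : borelAdelic F E c 3).2 0 * (diagUnit (t : borelAdelic F E c 3).2 1)⁻¹) diagUnitRatio_torus_mul).ker : Subgroup (torusInBorel F E c 3)) : Set (torusInBorel F E c 3)) := by
    haveI := t2Space_ideleGroup E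
    rw [MonoidHom.coe_ker]
    exact isClosed_singleton.preimage continuous_diagUnitRatioHom
  letI : CommGroup (torusInBorel F E c 3) := { (inferInstance : Group (torusInBorel F E c 3)) with mul_comm := torusInBorel_comm }
  obtain ⟨wS, hwS, hfin⟩ := exists_isCoveringWeight_ker_diagUnitRatio h2 hc hc1 (Measure.haar : Measure (MonoidHom.mk' (fun t : torusInBorel F E c 3 =>
      diagUnit (t : borelAdelic F E c 3).2 0 * (diagUnit (t : borelAdelic F E c 3).2 1)⁻¹) diagUnitRatio_torus_mul).ker)
  obtain ⟨C, hC0, hCt, hC⟩ := exists_lintegral_comp_mul_weight_eq_mul_setLIntegral (MonoidHom.mk' (fun t : torusInBorel F E c 3 =>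
      diagUnit (t : borelAdelic F E c 3).2 0 * (diagUnit (t : borelAdelic F E c 3).2 1)⁻¹) diagUnitRatio_torus_mul) ((rationalBorel F E c 3).subgroupOf (torusInBorel F E c 3)) continuous_diagUnitRatioHom
    (isOpenMap_diagUnitRatioHom hc) (diagUnitRatioHom_surjective hc) μT μE (Measure.haar : Measure (MonoidHom.mk' (fun t : torusInBorel F E c 3 =>
      diagUnit (t : borelAdelic F E c 3).2 0 * (diagUnit (t : borelAdelic F E c 3).2 1)⁻¹) diagUnitRatio_torus_mul).ker) hwS hfin
  refine ⟨C, hC0, hCt, fun w hw 𝓕 h𝓕 G hG hGinv => ?_⟩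
  have hmap := map_rationalTorusInBorel_diagUnitRatio_eq_principalIdeles (F := F) (E := E) (c := c) hc
  have huniq : ∀ x : (AdeleRing (𝓞 E) E)ˣ,
      ∃! l : ((rationalBorel F E c 3).subgroupOf (torusInBorel F E c 3)).map (MonoidHom.mk' (fun t : torusInBorel F E c 3 =>
      diagUnit (t : borelAdelic F E c 3).2 0 * (diagUnit (t : borelAdelic F E c 3).2 1)⁻¹) diagUnitRatio_torus_mul), l • x ∈ 𝓕 := by rw [hmap]; exact h𝓕.existsUnique
  have hGinv' : ∀ l ∈ ((rationalBorel F E c 3).subgroupOf (torusInBorel F E c 3)).map (MonoidHom.mk' (fun t : torusInBorel F E c 3 =>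
      diagUnit (t : borelAdelic F E c 3).2 0 * (diagUnit (t : borelAdelic F E c 3).2 1)⁻¹) diagUnitRatio_torus_mul), ∀ x : (AdeleRing (𝓞 E) E)ˣ, G (l * x) = G x := by rw [hmap]; exact hGinv
  exact hC w hw 𝓕 h𝓕.measurableSet huniq G hG hGinv'

end Row


/-! ## §4 The height dictionary `H(t) = ‖α₁(t)‖ · H(1)` (edition 2; asked by the (E)-assembly) -/

section Height

/-- **`‖d₁(t)‖_{𝔸_E} = 1` on `T(𝔸_F)`** (`[E : F] = 2`, `c ≠ 1`): `d₁(t) ∈ U(1)(𝔸_F)` (★ `diagUnit_one_mem_adelicOne`)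
`= U(1)_{E/F}(𝔸_F)` (★ `adelicOne_eq_relNormOneIdeles`) `≤ 𝕀_E¹` (★ `relNormOneIdeles_le_normOneIdeles`).
[cite: Rogawski1990, §2.2] -/
theorem ideleNorm_diagUnit_one_eq_one (h2 : Module.finrank F E = 2) (hc1 : c ≠ 1) (t : (torusInBorel F E c 3)) :
    IdeleClassGroup.ideleNorm E (diagUnit (t : borelAdelic F E c 3).2 1) = 1 := by
  have h1 : diagUnit (t : borelAdelic F E c 3).2 1 ∈ adelicOne F E c :=
    diagUnit_one_mem_adelicOne (torusPart_eq_self_of_mem t.2)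
  rw [adelicOne_eq_relNormOneIdeles F E c h2 hc1] at h1
  exact mem_normOneIdeles.1 (relNormOneIdeles_le_normOneIdeles F E h1)

/-- **`‖α₁(t)‖ = ‖d₀(t) d₁(t)⁻¹‖ = ‖d₀(t)‖`** on `T(𝔸_F)` (`‖d₁‖ = 1`). With ★ `modularCharacter_borelAdelic_torus` /
★ `torusRootModulus_three_eq` (`δ_B(t) = ‖d₀(t)‖²`) this is Rogawski's `δ_B = ‖α₁‖²` (p. 13). [cite: Rogawski1990, §2.2] -/
theorem ideleNorm_diagUnitRatio_eq (h2 : Module.finrank F E = 2) (hc1 : c ≠ 1) (t : (torusInBorel F E c 3)) :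
    IdeleClassGroup.ideleNorm E
        (diagUnit (t : borelAdelic F E c 3).2 0 * (diagUnit (t : borelAdelic F E c 3).2 1)⁻¹) =
      IdeleClassGroup.ideleNorm E (diagUnit (t : borelAdelic F E c 3).2 0) := by
  calc IdeleClassGroup.ideleNorm E
        (diagUnit (t : borelAdelic F E c 3).2 0 * (diagUnit (t : borelAdelic F E c 3).2 1)⁻¹)
      = IdeleClassGroup.ideleNorm E
          (diagUnit (t : borelAdelic F E c 3).2 0 * (diagUnit (t : borelAdelic F E c 3).2 1)⁻¹) *
          IdeleClassGroup.ideleNorm E (diagUnit (t : borelAdelic F E c 3).2 1) := by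
        rw [ideleNorm_diagUnit_one_eq_one h2 hc1 t, mul_one]
    _ = IdeleClassGroup.ideleNorm E (diagUnit (t : borelAdelic F E c 3).2 0) := by
        rw [← map_mul, inv_mul_cancel_right]

/-- **THE HEIGHT DICTIONARY `H(t) = ‖α₁(t)‖_{𝔸_E} · H(1)`** for `t ∈ T(𝔸_F)` (★ `borelHeight_torus_coe`: `H(t) = ‖d₀(t)‖ H(1)`,
and `‖α₁(t)‖ = ‖d₀(t)‖`): the truncation threshold `T < borelHeight t` of the LAW road reads `T < ‖α₁(t)‖ · H(1)` on the
idele side of `exists_lintegral_comp_diagUnitRatio_mul_weight_eq`. [cite: Rogawski1990, §2.2; §7.3 (p. 97)] -/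
theorem borelHeight_torus_coe_eq_ideleNorm_diagUnitRatio_mul (h2 : Module.finrank F E = 2) (hc1 : c ≠ 1)
    (t : (torusInBorel F E c 3)) :
    borelHeight (((t : borelAdelic F E c 3)) : (quasiSplit F E c 3).Adelic) =
      IdeleClassGroup.ideleNorm E
          (diagUnit (t : borelAdelic F E c 3).2 0 * (diagUnit (t : borelAdelic F E c 3).2 1)⁻¹) *
        borelHeight (1 : (quasiSplit F E c 3).Adelic) := by
  rw [ideleNorm_diagUnitRatio_eq h2 hc1 t]
  exact borelHeight_torus_coe t

/-- The dictionary along the homomorphism `α₁` itself: `H(t) = ‖α₁ t‖ · H(1)`. [cite: Rogawski1990, §2.2; §7.3 (p. 97)] -/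
theorem borelHeight_torus_coe_eq_ideleNorm_diagUnitRatioHom_mul (h2 : Module.finrank F E = 2) (hc1 : c ≠ 1)
    (t : (torusInBorel F E c 3)) :
    borelHeight (((t : borelAdelic F E c 3)) : (quasiSplit F E c 3).Adelic) =
      IdeleClassGroup.ideleNorm E ((MonoidHom.mk' (fun t : torusInBorel F E c 3 =>
      diagUnit (t : borelAdelic F E c 3).2 0 * (diagUnit (t : borelAdelic F E c 3).2 1)⁻¹) diagUnitRatio_torus_mul) t) *
        borelHeight (1 : (quasiSplit F E c 3).Adelic) :=
  borelHeight_torus_coe_eq_ideleNorm_diagUnitRatio_mul h2 hc1 t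

end Height

end UnitaryGroup

end Literature.NumberTheory.Automorphic
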